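import Mathlib
import HarnessLib
import Literature.Analysis.FluidPDE.TypeIAncientMildClassical
import Summits.NavierStokesRegularity.NavierStokesRegularity.Theorems.LocalTraceTubeDoorHarmonicOscillation
import Summits.NavierStokesRegularity.NavierStokesRegularity.Theorems.LocalSineTubeDoorProfileAlignedWindowRigidityAncient
import Summits.NavierStokesRegularity.NavierStokesRegularity.Theorems.PoloidalWindowDoorPoloidalWindowRigidityWindow
import Summits.NavierStokesRegularity.NavierStokesRegularity.Theorems.PoloidalWindowDoorPoloidalWindowRigidityFlat
import Summits.NavierStokesRegularity.NavierStokesRegularity.Theorems.LocalSineTubeDoorBoundedSubsolutionMaxPrinciple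

/-!
# The one-window door family — a SIGNED, SUB-CRITICAL stratum of the Type-I profile class:
# profiles whose pressure work is bounded below by `−κ|v|²/(−t)`, `κ < ½`, are trivial («Type-I blow-up must accelerate»)

Cell ns-regularity-ideate, seat p6 (route-directed support for nsreg-p1's door family; bears_on LADDER-NS N0; anchor
`--supports stmt-NavierStokesRegularity-20018`, the profile-rigidity item of the family).  Sequel of
`…LocalTraceTubeDoorProfileRigidity` (door S14: there the canonical pressure gradient VANISHES and `|v|²` is a
sub-solution); here only a ONE-SIDED, SUB-CRITICAL bound on the pressure work is assumed.  For a profile `v` of the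
family's Type-I class (rate `‖v(t,x)‖ ≤ C/√(−t)`, continuity on the open slab, unit-viscosity Oseen–Duhamel identity,
divergence-free slices) and a pressure `p` making it classical on the past `(−∞, 0)` (such `p` exist, tree
`exists_isClassicalNSSolutionOn_Iio_of_isTypeIAncientMild`; `∇p` is the same for all of them):

  **if `(−s)·⟪v(s,y), ∇p(s,y)⟫ ≥ −κ |v(s,y)|²` at every point of the slab for some `κ < ½`, then `v ≡ 0`**
  (`eq_zero_of_pressureWork_ge`); in particular DECELERATING profiles (`⟪v, ∇p⟫ ≥ 0`: the pressure never pushes the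
  fluid along its motion) are trivial (`eq_zero_of_pressureWork_nonneg`).

Proof.  By the pointwise energy balance `∂ₜq + (v·∇)q − Δq = −2⟪v,∇p⟫ − 2|Dv|²_F` (`energyDensity_balance`) the
WEIGHTED energy density `w = (−t)^β q`, `q = |v|²`, `β = max(2κ, 0) ∈ [0,1)`, satisfies
`∂ₜw + (v·∇)w − Δw ≤ (2κ − β)(−t)^{β−1} q − 2(−t)^β|Dv|²_F ≤ 0` (`weightedEnergy_subsolution`); it is bounded on every
slab `[t₀, t₁] × ℝ³`, `t₁ < 0`, by `C²(−t₁)^{β−1}` and starts below `C²(−t₀)^{β−1}`, so the whole-space maximum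
principle (`…BoundedSubsolutionMaxPrinciple.le_of_bounded_subsolution`) gives `w(t₁,x) ≤ C²(−t₀)^{β−1} → 0` as
`t₀ → −∞` BECAUSE `β < 1` — the Type-I rate `|v|² ≤ C²/(−t)` is exactly critical for `β = 1`, which is why the
threshold is `κ < ½` (at `κ = ½` the self-similar energy growth `∂ₜ|v|² = |v|²/(−t)` is formally compatible with the
balance).  Compare the vorticity analogue (nsreg-p7, `…PoloidalWindowRigidityCriticalProduction`: `(−t)⟪ω, Dv ω⟫ ≤ |ω|²`
everywhere ⇒ `v ≡ 0`) and the signed production stratum (`…EnstrophyProductionSigned`).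

No window door is attached (an inequality on a window does not spread by analyticity); this is a Liouville-type
statement on the profile class itself: a Type-I blow-up profile must be ACCELERATED by its pressure,
`(−t)⟪v, ∇p⟫ < −κ|v|²` somewhere on every slab `(−∞, t₁)`, for every `κ < ½`.

WHAT THIS IS NOT: not a claim about Navier–Stokes regularity (Clay A) — a settled signed stratum of the family's
profile class (bears_on LADDER-NS N0, door family support); establishment in the cell's sense still requires the
cross-family referee PASS + independent reproduction.
-/

noncomputable section

-- the summit and its single sub-problem share the name (CONVENTIONS §1), as in every Theorems file
set_option linter.dupNamespace false

namespace Summit.NavierStokesRegularity.NavierStokesRegularity.Theorems.LocalTraceTubeDoorPressureWorkLiouville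

open MeasureTheory Set Function Filter Topology TopologicalSpace Metric InnerProductSpace
open scoped RealInnerProductSpace InnerProductSpace Laplacian ContDiff
open Literature.Analysis Literature.Analysis.FluidPDE
open Summit.NavierStokesRegularity.NavierStokesRegularity.Theorems.LocalTraceTubeDoorHarmonicOscillation
open Summit.NavierStokesRegularity.NavierStokesRegularity.Theorems.LocalSineTubeDoorProfileAlignedWindowRigidityAncient
open Summit.NavierStokesRegularity.NavierStokesRegularity.Theorems.PoloidalWindowDoorPoloidalWindowRigidityWindow
open Summit.NavierStokesRegularity.NavierStokesRegularity.Theorems.PoloidalWindowDoorPoloidalWindowRigidityFlat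
open Summit.NavierStokesRegularity.NavierStokesRegularity.Theorems.LocalSineTubeDoorBoundedSubsolutionMaxPrinciple

variable {C : ℝ} {v : ℝ → EuclideanSpace ℝ (Fin 3) → EuclideanSpace ℝ (Fin 3)}
  {p : ℝ → EuclideanSpace ℝ (Fin 3) → ℝ}

/-- **The weighted energy density `w = (−t)^β |v|²` is a sub-solution** of `∂ₜw + (v·∇)w − Δw ≤ 0` on the open past,
for a classical solution `(v, p)` on `(−∞, 0)` whose pressure work satisfies `(−t)⟪v, ∇p⟫ ≥ −κ|v|²`, whenever
`2κ ≤ β` (two-sided time derivative `deriv`; `τ ↦ w(τ, x)` is differentiable):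
`∂ₜw + (v·∇)w − Δw = (−t)^β(−2⟪v,∇p⟫ − 2|Dv|²_F) − β(−t)^{β−1}|v|² ≤ (2κ − β)(−t)^{β−1}|v|² ≤ 0`. -/
theorem weightedEnergy_subsolution (hcl : IsClassicalNSSolutionOn (Iio 0) 1 0 v p) {κ β : ℝ} (hβκ : 2 * κ ≤ β)
    (hpw : ∀ s < 0, ∀ y : EuclideanSpace ℝ (Fin 3), -κ * ⟪v s y, v s y⟫_ℝ ≤ (-s) * ⟪v s y, gradient (p s) y⟫_ℝ)
    {t : ℝ} (ht : t < 0) (x : EuclideanSpace ℝ (Fin 3)) :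
    HasDerivAt (fun τ => (-τ) ^ β * ⟪v τ x, v τ x⟫_ℝ) (deriv (fun τ => (-τ) ^ β * ⟪v τ x, v τ x⟫_ℝ) t) t ∧
      deriv (fun τ => (-τ) ^ β * ⟪v τ x, v τ x⟫_ℝ) t +
          fderiv ℝ (fun y => (-t) ^ β * ⟪v t y, v t y⟫_ℝ) x (v t x) -
          (Δ (fun y => (-t) ^ β * ⟪v t y, v t y⟫_ℝ)) x ≤ 0 := by
  have hnt : 0 < -t := neg_pos.2 ht
  have hbal := energyDensity_balance isOpen_Iio hcl ht x
  have hv2 : ContDiff ℝ 2 (v t) := contDiff_infty.1 (hcl.contDiff_velocity ht) 2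
  have hq2 : ContDiff ℝ 2 (fun y => ⟪v t y, v t y⟫_ℝ) := hv2.inner ℝ hv2
  have hqd : DifferentiableAt ℝ (fun y => ⟪v t y, v t y⟫_ℝ) x := (hq2.differentiable (by norm_num)) x
  -- the time derivative of `q = |v|²` is the one-sided derivative within the open past
  have hdu : HasDerivWithinAt (fun τ => v τ x) (timeDerivWithin (Iio 0) v t x) (Iio 0) t := by
    rw [timeDerivWithin_apply]
    exact (hcl.smooth_velocity.differentiableWithinAt_time ht x).hasDerivWithinAt
  have hq : HasDerivAt (fun τ => ⟪v τ x, v τ x⟫_ℝ)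
      (⟪v t x, timeDerivWithin (Iio 0) v t x⟫_ℝ + ⟪timeDerivWithin (Iio 0) v t x, v t x⟫_ℝ) t :=
    (hdu.inner ℝ hdu).hasDerivAt (isOpen_Iio.mem_nhds ht)
  have hqderiv : deriv (fun τ => ⟪v τ x, v τ x⟫_ℝ) t =
      timeDerivWithin (Iio 0) (fun τ y => ⟪v τ y, v τ y⟫_ℝ) t x := by
    rw [timeDerivWithin_apply, derivWithin_of_isOpen isOpen_Iio ht]
  have hq' : HasDerivAt (fun τ => ⟪v τ x, v τ x⟫_ℝ) (deriv (fun τ => ⟪v τ x, v τ x⟫_ℝ) t) t :=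
    hq.differentiableAt.hasDerivAt
  -- the weight `(−τ)^β` and its derivative
  have hpow : HasDerivAt (fun τ => (-τ) ^ β) (-1 * β * (-t) ^ (β - 1)) t := by
    have h := (hasDerivAt_neg t).rpow_const (p := β) (Or.inl hnt.ne')
    simpa using h
  have hw : HasDerivAt (fun τ => (-τ) ^ β * ⟪v τ x, v τ x⟫_ℝ)
      (-1 * β * (-t) ^ (β - 1) * ⟪v t x, v t x⟫_ℝ + (-t) ^ β * deriv (fun τ => ⟪v τ x, v τ x⟫_ℝ) t) t :=
    hpow.mul hq'
  refine ⟨hw.differentiableAt.hasDerivAt, ?_⟩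
  rw [hw.deriv]
  -- spatial derivatives of `w(t, ·) = (−t)^β • q(t, ·)`
  have hX : fderiv ℝ (fun y => (-t) ^ β * ⟪v t y, v t y⟫_ℝ) x (v t x) =
      (-t) ^ β * fderiv ℝ (fun y => ⟪v t y, v t y⟫_ℝ) x (v t x) := by
    rw [show (fun y => (-t) ^ β * ⟪v t y, v t y⟫_ℝ) = fun y => (-t) ^ β • ⟪v t y, v t y⟫_ℝ from rfl,
      fderiv_fun_const_smul hqd]
    rfl
  have hL : (Δ (fun y => (-t) ^ β * ⟪v t y, v t y⟫_ℝ)) x = (-t) ^ β * (Δ (fun y => ⟪v t y, v t y⟫_ℝ)) x := by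
    have e : (fun y => (-t) ^ β * ⟪v t y, v t y⟫_ℝ) = (-t) ^ β • fun y => ⟪v t y, v t y⟫_ℝ := by
      funext y; simp [smul_eq_mul]
    rw [e, InnerProductSpace.laplacian_smul _ hq2.contDiffAt, smul_eq_mul]
  rw [hX, hL, hqderiv]
  -- the balance, the hypothesis and the signs
  set c : ℝ := (-t) ^ β with hc
  set c' : ℝ := (-t) ^ (β - 1) with hc'
  have hc'0 : 0 < c' := Real.rpow_pos_of_pos hnt _
  have hcc' : c = (-t) * c' := by
    rw [hc, hc', show β = β - 1 + 1 by ring, Real.rpow_add hnt, Real.rpow_one]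
    ring_nf
  have hP := hpw t ht x
  have hq0 : 0 ≤ ⟪v t x, v t x⟫_ℝ := real_inner_self_nonneg
  have hF : 0 ≤ frobeniusNormSq (fderiv ℝ (v t) x) := frobeniusNormSq_nonneg _
  -- `E = −β c' q + c·(∂ₜq + Dq(v) − Δq) = −β c' q + c(−2P − 2F)`
  have key : -1 * β * c' * ⟪v t x, v t x⟫_ℝ +
        c * (timeDerivWithin (Iio 0) (fun τ y => ⟪v τ y, v τ y⟫_ℝ) t x +
          fderiv ℝ (fun y => ⟪v t y, v t y⟫_ℝ) x (v t x) - (1 : ℝ) * (Δ (fun y => ⟪v t y, v t y⟫_ℝ)) x) ≤ 0 := by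
    rw [hbal, hcc']
    have h2 : (-t) * (-2 * ⟪v t x, gradient (p t) x⟫_ℝ) ≤ 2 * κ * ⟪v t x, v t x⟫_ℝ := by nlinarith
    have h3 : -1 * β * c' * ⟪v t x, v t x⟫_ℝ + (-t) * c' * (-2 * ⟪v t x, gradient (p t) x⟫_ℝ) ≤
        (2 * κ - β) * c' * ⟪v t x, v t x⟫_ℝ := by nlinarith [mul_le_mul_of_nonneg_left h2 hc'0.le]
    have h4 : (2 * κ - β) * c' * ⟪v t x, v t x⟫_ℝ ≤ 0 :=
      mul_nonpos_of_nonpos_of_nonneg (mul_nonpos_of_nonpos_of_nonneg (by linarith) hc'0.le) hq0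
    nlinarith [mul_nonneg (mul_nonneg hnt.le hc'0.le) hF]
  nlinarith [key]

/-- **TYPE-I PROFILES WITH SUB-CRITICALLY BOUNDED PRESSURE WORK ARE TRIVIAL.**  If `v` is a profile of the family's
Type-I class, `p` a pressure making it classical on `(−∞, 0)`, and `(−s)⟪v(s,y), ∇p(s,y)⟫ ≥ −κ|v(s,y)|²` everywhere
for some `κ < ½`, then `v ≡ 0`: the weighted energy `(−t)^β|v|²`, `β = max(2κ,0) < 1`, is a bounded sub-solution on
every slab `[t₀, t₁] × ℝ³` (`weightedEnergy_subsolution`), so `(−t₁)^β|v(t₁,x)|² ≤ C²(−t₀)^{β−1} → 0` as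
`t₀ → −∞` (`le_of_bounded_subsolution`). -/
theorem eq_zero_of_pressureWork_ge (hrate : HasTypeITimeDecay C v)
    (hcont : ContinuousOn (uncurry v) (Iio (0 : ℝ) ×ˢ univ))
    (hmild : ∀ s t : ℝ, s < t → t < 0 → ∀ x,
      v t x = UnboundedOperators.heatExtension (v s) (t - s) x - oseenDuhamel 1 s v v t x)
    (hdiv : ∀ t < 0, VectorCalculus.IsDivFree (v t))
    (hcl : IsClassicalNSSolutionOn (Iio 0) 1 0 v p) {κ : ℝ} (hκ : κ < 1 / 2)
    (hpw : ∀ s < 0, ∀ y : EuclideanSpace ℝ (Fin 3), -κ * ⟪v s y, v s y⟫_ℝ ≤ (-s) * ⟪v s y, gradient (p s) y⟫_ℝ) :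
    ∀ t < 0, ∀ x, v t x = 0 := by
  have hA : IsTypeIAncientMild C v := isTypeIAncientMild_of_class hrate hcont hmild hdiv
  have hC0 : 0 ≤ C := by
    have h := hrate (-1) (by norm_num) 0
    rw [neg_neg, Real.sqrt_one, div_one] at h
    exact (norm_nonneg _).trans h
  -- the exponent
  set β : ℝ := max (2 * κ) 0 with hβ
  have hβ0 : 0 ≤ β := le_max_right _ _
  have hβκ : 2 * κ ≤ β := le_max_left _ _
  have hβ1 : β < 1 := max_lt (by linarith) one_pos
  -- the weighted energy density and its time derivative
  set w : ℝ → EuclideanSpace ℝ (Fin 3) → ℝ := fun τ y => (-τ) ^ β * ⟪v τ y, v τ y⟫_ℝ with hwdef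
  set wt : ℝ → EuclideanSpace ℝ (Fin 3) → ℝ := fun τ y => deriv (fun τ' => w τ' y) τ with hwtdef
  have hsm : IsSmoothSpaceTimeOn (Iio 0) v := hA.contDiffOn
  -- the rate in weighted form: `w(t, x) ≤ C² (−t)^(β−1)`
  have hwbd : ∀ t < 0, ∀ x, w t x ≤ C ^ 2 * (-t) ^ (β - 1) := fun t ht x => by
    have hnt : 0 < -t := neg_pos.2 ht
    have h1 := hrate t ht x
    have h2 : ‖v t x‖ ^ 2 ≤ (C / Real.sqrt (-t)) ^ 2 := pow_le_pow_left₀ (norm_nonneg _) h1 2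
    rw [div_pow, Real.sq_sqrt hnt.le] at h2
    simp only [hwdef, real_inner_self_eq_norm_sq]
    have h3 : (-t) ^ β * ‖v t x‖ ^ 2 ≤ (-t) ^ β * (C ^ 2 / (-t)) :=
      mul_le_mul_of_nonneg_left h2 (Real.rpow_nonneg hnt.le _)
    refine h3.trans_eq ?_
    have htne : t ≠ 0 := ht.ne
    rw [show β = β - 1 + 1 by ring, Real.rpow_add hnt, Real.rpow_one, show β - 1 + 1 - 1 = β - 1 by ring]
    field_simp
  have hw0 : ∀ t < 0, ∀ x, 0 ≤ w t x := fun t ht x => by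
    simp only [hwdef]
    exact mul_nonneg (Real.rpow_nonneg (neg_pos.2 ht).le _) real_inner_self_nonneg
  intro t₁ ht₁ x₁
  -- `w(t₁, x₁) ≤ C² (−t₀)^(β−1)` for every `t₀ < t₁`
  have hkey : ∀ t₀ < t₁, w t₁ x₁ ≤ C ^ 2 * (-t₀) ^ (β - 1) := by
    intro t₀ ht₀
    have hnt₁ : 0 < -t₁ := neg_pos.2 ht₁
    -- drift bound on `[t₀, t₁]`
    obtain ⟨B, hB⟩ := bdd_of_hasTypeITimeDecay hrate (-t₁ / 2) (by linarith)
    have hbA : ∀ t ∈ Icc t₀ t₁, ∀ x, ‖v t x‖ ≤ B := fun t ht x => hB t (by linarith [ht.2]) x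
    -- continuity of `w` on the closed slab
    have hw_c : ContinuousOn (uncurry w) (Icc t₀ t₁ ×ˢ univ) := by
      have hvc : ContinuousOn (uncurry v) (Icc t₀ t₁ ×ˢ univ) :=
        hsm.continuousOn.mono (prod_mono (fun t ht => lt_of_le_of_lt ht.2 ht₁) Subset.rfl)
      have hq : ContinuousOn (fun z => ⟪uncurry v z, uncurry v z⟫_ℝ) (Icc t₀ t₁ ×ˢ univ) := hvc.inner hvc
      have hρ : ContinuousOn (fun z : ℝ × EuclideanSpace ℝ (Fin 3) => (-z.1) ^ β) (Icc t₀ t₁ ×ˢ univ) :=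
        (continuous_fst.neg.continuousOn).rpow_const fun z _ => Or.inr hβ0
      refine (hρ.mul hq).congr fun z _ => ?_
      simp only [hwdef, uncurry, Pi.mul_apply]
    -- smooth slices
    have hw2 : ∀ t ∈ Icc t₀ t₁, ContDiff ℝ 2 (w t) := fun t ht => by
      have htn : t < 0 := lt_of_le_of_lt ht.2 ht₁
      have hV : ContDiff ℝ 2 (v t) :=
        (analyticOnNhd_slice hcont (bdd_of_hasTypeITimeDecay hrate) hmild htn).contDiff
      exact contDiff_const.mul (hV.inner ℝ hV)
    -- time derivative and the sub-solution inequality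
    have hsub := fun t (ht : t ∈ Icc t₀ t₁) x =>
      weightedEnergy_subsolution hcl hβκ hpw (lt_of_le_of_lt ht.2 ht₁) x
    have hwt : ∀ x, ∀ t ∈ Icc t₀ t₁, HasDerivAt (fun τ => w τ x) (wt t x) t := fun x t ht => (hsub t ht x).1
    have hlaw : ∀ t ∈ Icc t₀ t₁, ∀ x, wt t x + fderiv ℝ (w t) x (v t x) - (Δ (w t)) x ≤ 0 :=
      fun t ht x => (hsub t ht x).2
    -- bounds
    have hbdd : ∀ t ∈ Icc t₀ t₁, ∀ x, |w t x| ≤ C ^ 2 * (-t₁) ^ (β - 1) := fun t ht x => by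
      have htn : t < 0 := lt_of_le_of_lt ht.2 ht₁
      rw [abs_of_nonneg (hw0 t htn x)]
      refine (hwbd t htn x).trans (mul_le_mul_of_nonneg_left ?_ (sq_nonneg C))
      exact Real.rpow_le_rpow_of_nonpos hnt₁ (by linarith [ht.2]) (by linarith)
    have hinit : ∀ x, w t₀ x ≤ C ^ 2 * (-t₀) ^ (β - 1) := fun x => hwbd t₀ (ht₀.trans ht₁) x
    exact le_of_bounded_subsolution ht₀ hbA hw_c hw2 hwt hlaw hbdd hinit t₁ ⟨ht₀.le, le_rfl⟩ x₁
  -- let `t₀ → −∞`: `C² X^(β−1) → 0` as `X → ∞` since `β < 1`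
  have hwle : w t₁ x₁ ≤ 0 := by
    refine le_of_forall_pos_le_add fun η hη => ?_
    have hγ : 0 < 1 - β := by linarith
    have hlim : Tendsto (fun X : ℝ => C ^ 2 * X ^ (-(1 - β))) atTop (nhds (C ^ 2 * 0)) :=
      (tendsto_rpow_neg_atTop hγ).const_mul (C ^ 2)
    rw [mul_zero] at hlim
    obtain ⟨X, hXη, hXt⟩ := ((hlim.eventually_le_const hη).and (eventually_ge_atTop (-t₁ + 1))).exists
    have hX0 : 0 < X := by linarith [neg_pos.2 ht₁]
    have ht₀ : -X < t₁ := by linarith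
    have h1 := hkey (-X) ht₀
    rw [neg_neg, show β - 1 = -(1 - β) by ring] at h1
    linarith
  have hnt₁ : 0 < -t₁ := neg_pos.2 ht₁
  have hw00 : w t₁ x₁ = 0 := le_antisymm hwle (hw0 t₁ ht₁ x₁)
  have hq0 : ⟪v t₁ x₁, v t₁ x₁⟫_ℝ = 0 := by
    have hpos : 0 < (-t₁) ^ β := Real.rpow_pos_of_pos hnt₁ _
    have h : (-t₁) ^ β * ⟪v t₁ x₁, v t₁ x₁⟫_ℝ = 0 := hw00
    rcases mul_eq_zero.1 h with h | h
    · exact absurd h hpos.ne'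
    · exact h
  exact inner_self_eq_zero.1 hq0

/-- **DECELERATING TYPE-I PROFILES ARE TRIVIAL** (`κ = 0`): if the pressure work `⟪v, ∇p⟫` is everywhere
non-negative on the past, the profile vanishes identically. -/
theorem eq_zero_of_pressureWork_nonneg (hrate : HasTypeITimeDecay C v)
    (hcont : ContinuousOn (uncurry v) (Iio (0 : ℝ) ×ˢ univ))
    (hmild : ∀ s t : ℝ, s < t → t < 0 → ∀ x,
      v t x = UnboundedOperators.heatExtension (v s) (t - s) x - oseenDuhamel 1 s v v t x)
    (hdiv : ∀ t < 0, VectorCalculus.IsDivFree (v t))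
    (hcl : IsClassicalNSSolutionOn (Iio 0) 1 0 v p)
    (hpw : ∀ s < 0, ∀ y : EuclideanSpace ℝ (Fin 3), 0 ≤ ⟪v s y, gradient (p s) y⟫_ℝ) :
    ∀ t < 0, ∀ x, v t x = 0 :=
  eq_zero_of_pressureWork_ge hrate hcont hmild hdiv hcl (κ := 0) (by norm_num) fun s hs y => by
    have h := hpw s hs y
    have hs0 : 0 ≤ -s := (neg_pos.2 hs).le
    nlinarith

/-- **The sub-critical pressure-work stratum of the family's profile class is settled**: such a profile is not
backward-singular at the apex. -/
theorem not_backwardSingular_of_pressureWork_ge (hrate : HasTypeITimeDecay C v)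
    (hcont : ContinuousOn (uncurry v) (Iio (0 : ℝ) ×ˢ univ))
    (hmild : ∀ s t : ℝ, s < t → t < 0 → ∀ x,
      v t x = UnboundedOperators.heatExtension (v s) (t - s) x - oseenDuhamel 1 s v v t x)
    (hdiv : ∀ t < 0, VectorCalculus.IsDivFree (v t))
    (hcl : IsClassicalNSSolutionOn (Iio 0) 1 0 v p) {κ : ℝ} (hκ : κ < 1 / 2)
    (hpw : ∀ s < 0, ∀ y : EuclideanSpace ℝ (Fin 3), -κ * ⟪v s y, v s y⟫_ℝ ≤ (-s) * ⟪v s y, gradient (p s) y⟫_ℝ) :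
    ¬ IsBackwardSingularPoint v 0 :=
  not_backwardSingular_of_zero (eq_zero_of_pressureWork_ge hrate hcont hmild hdiv hcl hκ hpw)

end Summit.NavierStokesRegularity.NavierStokesRegularity.Theorems.LocalTraceTubeDoorPressureWorkLiouville

end
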